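import Summits.QuantumFields.YangMills.Theorems.UnitScaleTiltProp7KernelRowColumnGauge
import Summits.QuantumFields.YangMills.Theorems.UnitScaleTiltProp7QkPenaltyKernelRow
import Summits.QuantumFields.YangMills.Theorems.UnitScaleTiltProp7QTwSColumnBound
import Summits.QuantumFields.YangMills.Theorems.UnitScaleTiltProp7Op137OfKernelRows
import HarnessLib

/-!
# Route `UnitScaleTilt`, crux K1 «MinimiserStabilityRegPr» (stmt-QuantumFields-19200), EX face — K137 STOREY, road (K3)∕(K4) of LOCATE-K137, FILE (K3-alg):
# **KERNEL ROWS BETWEEN THE COARSE AND THE FINE CARRIER** — one abstract Schur composition for displayed pointwise kernel rows with positions in the coarse pseudo-metric,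
# the member's two volumes, and THE TWO TUBE ROWS OF THE AVERAGING OPERATOR OF RECORD: `Q_k(U₀)†` (coarse → fine) and `Q_k(U₀)` (fine → coarse) carry a kernel row AT EVERY RATE,
# unconditionally at a printed-regular background

Cell `ym3-torus` (HUMAN RULING D-0037; rung R3 = SU(2) YM₃ on T³ — NOT d = 4, NOT infinite volume, NOT a mass gap, NOT Clay).  Width seat `ym3-torus-px10` (gen 13; FREE px),
successor pen named by px10 g12 ■ («(K3)∕(K4) compositions of LOCATE-K137») and px12 g16 ■ («NEXT FREE PENS: … (K3) the `Qk†`-composition door»); LOCATE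
`HOME/ym3-torus-px10/g13/LOCATE-K3-QKDAGGER-DOOR-px10g13.md` (19200 evidence #48).  THEOREMS ONLY (0 `def`, 0 `sorry`, default heartbeats); `--supports stmt-QuantumFields-19200 --as helper`;
count-neutral.  Part 2 = `…Prop7Kernel137DoorOfKinvEntry` (the doors for the EX rows `h137kπ`∕`h137kΔ`), part 3 = the `hCk` door.
THE FOUR TEXTS (stated inline, never defined).  Member `(F, n ≤ K)`, weights `c₀` (fine, ✓`toL2`) and `cB` (coarse, ✓`toL2B`); every index is PLACED on the coarse torus
`Site (F.P K) (K − n)`: a fine bond `b` at its block `B(b) := iterBlockOf (K−n) b.src`, a coarse bond `y : PBond (F.P n) 0` at `ŷ := siteShift (sites_eq F n K h) y.src`; `dc := tdist` there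
(✓`Prop7BlockDistanceWeights` (W3): symmetric, triangle).  For linear maps between the carriers:
* FF(B; C, μ) := `∀ b Z b_d, ‖toL2⁻¹(B(toL2(δ_b Z)))(b_d)‖ ≤ C·e^{−μ·dc(B b, B b_d)}·‖Z‖` — px10 g12's ROW (✓`Prop7KernelRowColumnGauge`), O4e's `hk`, the EX rows `h349`∕`hCk`;
* CF(T; C, μ) := `∀ y Z b, ‖toL2⁻¹(T(toL2B(δ_y Z)))(b)‖ ≤ C·e^{−μ·dc(B b, ŷ)}·‖Z‖` — the text of the EX rows `h137kπ`∕`h137kΔ` (✓`Prop7Op137OfKernelRows.h137_of_kernel137_family_slot`'s `h137k`);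
* FC(S; C, μ) := `∀ b Z y′, ‖toL2B⁻¹(S(toL2(δ_b Z)))(y′)‖ ≤ C·e^{−μ·dc(ŷ′, B b)}·‖Z‖`;
* CC(M; C, μ) := `∀ y Z y′, ‖toL2B⁻¹(M(toL2B(δ_y Z)))(y′)‖ ≤ C·e^{−μ·dc(ŷ′, ŷ)}·‖Z‖` — the shape px12 g16 ✓`Prop7KinvConjugateDecay.norm_symm_Kinv_single_le_of_conj_accretive` delivers for
  `(Q_kGQ_k†)⁻¹` with px12 g13's block-distance weights.
THE ARGUMENT.  §0 is ONE abstract lemma: three finite index types with position maps `p₁ p₂ p₃` into a pseudo-metric space and linear charts `eᵢ : (ιᵢ → V) ≃ₗ Eᵢ`; if `A` has the row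
`‖e₂⁻¹(A(e₁ δ_i Z))(j)‖ ≤ C_A e^{−μ_A d(p₂ j, p₁ i)}‖Z‖` and `B` the row `C_B e^{−μ_B d(p₃ k, p₂ j)}`, then — expanding the middle vector in spikes, `d(p₃k,p₁i) ≤ d(p₃k,p₂j) + d(p₂j,p₁i)`, and trading
the surplus rates `ν_B := μ_B − r`, `ν_A := μ_A − r` for the middle volume `Σ_j e^{−ν_B d(p₃k,p₂j)}e^{−ν_A d(p₂j,p₁i)} ≤ S` — `B∘A` has the row `C_BC_AS·e^{−r d(p₃k,p₁i)}` (★`kernelRow_comp_core`, one-sided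
★`kernelRow_comp_outer`∕`_inner`).  §1: the fine middle volume `Σ_b e^{−ν dc(x,B b)} ≤ d(L^d)^{K−n}(2(1+1∕ν))³` (px10 g12 ✓`sum_pbond_blockwise` + ✓`sum_exp_neg_mul_tdist_coarse_le`; the coarse one is
✓`sum_coarse_pbond_exp_neg_tdist_le` BY NAME) — the `ℓ³` that the `ℓ⁻³` of `Q_k`'s row eats (★p1 g26 CHAIR WORDs №13∕№14).  §2: the four member-level compositions the doors use —
★`kernelRow_CF_comp_CC` (rows `h137k•`: `Q_k†∘(K⁻¹ − a)`), ★`kernelRow_FC_comp_FF` (`Q_k∘G_T`), ★`kernelRow_CC_comp_FC`, ★`kernelRow_CF_comp_FC` (→ FF, px10 g12's text: row `hCk`).  §3: THE TUBE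
ROWS.  By px21 ✓`QTwS_single_eq_zero_of_not_read` the averaging of record does not see a one-bond spike outside its read set, so (px17's duality ✓`inner_toL2_single_adjoint_Qk`) the `(b, y′)`
entry of `Q_k†` and the `(y′, b)` entry of `Q_k` VANISH unless `B(b) ∈ {ŷ′, ŷ′⁺}`, where `dc(B b, ŷ′) ≤ 1` (✓`tdist_src_tgt_le_one`) and `1 ≤ e^{μ}e^{−μ·dc}`; the sizes are px13's unconditional
(COL) consequences ✓`norm_toL2_symm_adjoint_Qk_apply_le_of_regPr` (`2C_Q(cB∕c₀)ℓ⁻³`, `C_Q ≤ 5` ✓`col_const_le_five`) and one term of ✓`col_of_regPr` times `η = ℓ⁻¹`: ★★`kernelRow_Qk_of_regPr`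
(FC(Q_k; 5ℓ⁻³e^{μ}, μ)) and ★★`kernelRow_adjoint_Qk_of_regPr` (CF(Q_k†; 10(cB∕c₀)ℓ⁻³e^{μ}, μ)), EVERY `μ ≥ 0`.
HONEST SCOPE.  Schur bookkeeping over landed letters; the only analysis is the cited tube locality and (COL), both theorems at `RegPr`.  Nothing of the `K⁻¹` entry rows ((K1)+(K2), px12∕px13∕px16∕
px21 lineage), of (3.132), of the ten EX rows, EX or the crux is proved here; the Yang–Mills mass gap is NOT proved.

References: T. Bałaban, CMP **99** (1985) 389–434 [Balaban1985BackgroundPropagators] ((3.13)–(3.16) p.393, (3.46)–(3.49) pp.398–399, (3.124)–(3.126) p.420, (3.132)–(3.133) p.422); CMP **96** (1984)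
223–250 [Balaban1984PropagatorsII] (§2, (2.61) p.234: compositions of kernels with exponential decay); CMP **102** (1985) 277–309 [Balaban1985Variational] ((137) p.298). -/

set_option autoImplicit false

noncomputable section

open scoped BigOperators Matrix.Norms.L2Operator InnerProductSpace ComplexConjugate

namespace Summit.QuantumFields.YangMills.Theorems.Prop7CoarseFineKernelRows

open Literature.MathematicalPhysics.QuantumFieldTheory.Balaban1983to89
open Literature.MathematicalPhysics.QuantumFieldTheory.Balaban1983to89.T3ContinuumYM3Torus
open T3SectALandauChart (eta eta_pos)
open T3PrintedRegularMinimiser (RegPr)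
open T3PrintedRegularOrbits (sites_eq)
open T3LevelShift (siteShift bondShift bondShift_src bondShift_tgt)
open B9Eq311L2Pairing (WL2)
open B11Eq103H1Complex (BondL2K)
open B5Eq118OneStroke (iterBlockOf)
open Summit.QuantumFields.YangMills.Theorems.Prop7SectET3Transport (periodsT3)
open Summit.QuantumFields.YangMills.Theorems.Prop7SectET3HilbertLetters (W₂ frobEquiv toL2 toL2B inner_toL2 inner_toL2B toL2_apply toL2_symm_apply toL2B_symm_apply)
open Summit.QuantumFields.YangMills.Theorems.Prop7SectET3CurvedPropagators (Qk)
open Summit.QuantumFields.YangMills.Theorems.Prop7SymAvgTwSym (QTwS)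
open Summit.QuantumFields.YangMills.Theorems.Prop7TransverseRowOfTubeRowRegPr (Qk_toL2)
open Summit.QuantumFields.YangMills.Theorems.Prop7QkAdjointSupRowOfRegPr (inner_toL2_single_adjoint_Qk inner_toL2_single_self)
open Summit.QuantumFields.YangMills.Theorems.Prop7QkPenaltyKernelRow (QTwS_single_eq_zero_of_not_read)
open Summit.QuantumFields.YangMills.Theorems.Prop7QTwSColumnBound (col_of_regPr col_const_le_five norm_toL2_symm_adjoint_Qk_apply_le_of_regPr)
open Summit.QuantumFields.YangMills.Theorems.Prop7BlockDistanceWeights (tdist_src_tgt_le_one sum_exp_neg_mul_tdist_coarse_le tdist_coarse_comm tdist_coarse_triangle)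
open Summit.QuantumFields.YangMills.Theorems.Prop7KernelRowColumnGauge (sum_pbond_blockwise tdist_coarse_self)
open Summit.QuantumFields.YangMills.Theorems.Prop7Op137OfKernelRows (sum_coarse_pbond_exp_neg_tdist_le)

/-! ## §0 The abstract Schur composition of two displayed kernel rows -/

section Abstract
variable {ι₁ ι₂ ι₃ X V E₁ E₂ E₃ : Type*} [Fintype ι₂] [DecidableEq ι₁] [DecidableEq ι₂]
  [NormedAddCommGroup V] [Module ℂ V]
  [AddCommGroup E₁] [Module ℂ E₁] [AddCommGroup E₂] [Module ℂ E₂] [AddCommGroup E₃] [Module ℂ E₃]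

/-- Rate bookkeeping: `a, b ≥ 0`, `t ≤ a + b`, `0 ≤ r`, `r + ν_A ≤ μ_A`, `r + ν_B ≤ μ_B` ⟹ `e^{−μ_B a}·e^{−μ_A b} ≤ e^{−r t}·(e^{−ν_B a}·e^{−ν_A b})`. [folklore] -/
theorem exp_mul_exp_le_of_triangle {a b t r μA μB νA νB : ℝ} (ha : 0 ≤ a) (hb : 0 ≤ b) (ht : t ≤ a + b) (hr : 0 ≤ r)
    (hA : r + νA ≤ μA) (hB : r + νB ≤ μB) :
    Real.exp (-(μB * a)) * Real.exp (-(μA * b)) ≤ Real.exp (-(r * t)) * (Real.exp (-(νB * a)) * Real.exp (-(νA * b))) := by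
  rw [← Real.exp_add, ← Real.exp_add, ← Real.exp_add, Real.exp_le_exp]
  have h1 : (r + νA) * b ≤ μA * b := mul_le_mul_of_nonneg_right hA hb
  have h2 : (r + νB) * a ≤ μB * a := mul_le_mul_of_nonneg_right hB ha
  have h3 : r * t ≤ r * (a + b) := mul_le_mul_of_nonneg_left ht hr
  nlinarith [h1, h2, h3]

/-- ★ **THE ABSTRACT SCHUR COMPOSITION (two-sided absorption)**: index types placed by `p₁ p₂ p₃` in a pseudo-metric space `(X, d)` (`d ≥ 0`, triangle), linear charts `eᵢ : (ιᵢ → V) ≃ₗ Eᵢ`;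
if `A` has the pointwise row `‖e₂⁻¹(A(e₁ δ_i Z))(j)‖ ≤ C_A·e^{−μ_A d(p₂ j, p₁ i)}·‖Z‖`, `B` the row `C_B·e^{−μ_B d(p₃ k, p₂ j)}`, `0 ≤ r`, `r + ν_A ≤ μ_A`, `r + ν_B ≤ μ_B`, and the middle volume is
`Σ_j e^{−ν_B d(x, p₂ j)}e^{−ν_A d(p₂ j, z)} ≤ S`, then `B∘A` has the row `C_B·C_A·S·e^{−r d(p₃ k, p₁ i)}`. [cite: Balaban1984PropagatorsII, §2 (2.61) p.234; Balaban1985BackgroundPropagators, (3.49) p.399] -/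
theorem kernelRow_comp_core (e₁ : (ι₁ → V) ≃ₗ[ℂ] E₁) (e₂ : (ι₂ → V) ≃ₗ[ℂ] E₂) (e₃ : (ι₃ → V) ≃ₗ[ℂ] E₃)
    (d : X → X → ℝ) (hd0 : ∀ x y, 0 ≤ d x y) (hdt : ∀ x y z, d x z ≤ d x y + d y z)
    (p₁ : ι₁ → X) (p₂ : ι₂ → X) (p₃ : ι₃ → X) (A : E₁ →ₗ[ℂ] E₂) (B : E₂ →ₗ[ℂ] E₃)
    {CA CB μA μB r νA νB S : ℝ} (hCA : 0 ≤ CA) (hCB : 0 ≤ CB) (hr : 0 ≤ r) (hνA : r + νA ≤ μA) (hνB : r + νB ≤ μB)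
    (hvol : ∀ x z : X, ∑ j, Real.exp (-(νB * d x (p₂ j))) * Real.exp (-(νA * d (p₂ j) z)) ≤ S)
    (hA : ∀ (i : ι₁) (Z : V) (j : ι₂), ‖e₂.symm (A (e₁ (Pi.single i Z))) j‖ ≤ CA * Real.exp (-(μA * d (p₂ j) (p₁ i))) * ‖Z‖)
    (hB : ∀ (j : ι₂) (W : V) (k : ι₃), ‖e₃.symm (B (e₂ (Pi.single j W))) k‖ ≤ CB * Real.exp (-(μB * d (p₃ k) (p₂ j))) * ‖W‖)
    (i : ι₁) (Z : V) (k : ι₃) :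
    ‖e₃.symm (B (A (e₁ (Pi.single i Z)))) k‖ ≤ CB * CA * S * Real.exp (-(r * d (p₃ k) (p₁ i))) * ‖Z‖ := by
  -- expand the middle vector in spikes
  set W : ι₂ → V := e₂.symm (A (e₁ (Pi.single i Z))) with hW
  have hAW : A (e₁ (Pi.single i Z)) = e₂ W := by rw [hW, LinearEquiv.apply_symm_apply]
  have hsum : e₃.symm (B (A (e₁ (Pi.single i Z)))) k = ∑ j, e₃.symm (B (e₂ (Pi.single j (W j)))) k := by
    rw [hAW]
    conv_lhs => rw [← Finset.univ_sum_single W]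
    rw [map_sum, map_sum, map_sum, Finset.sum_apply]
  rw [hsum]
  refine (norm_sum_le _ _).trans ?_
  have hterm : ∀ j, ‖e₃.symm (B (e₂ (Pi.single j (W j)))) k‖
      ≤ CB * CA * ‖Z‖ * Real.exp (-(r * d (p₃ k) (p₁ i))) * (Real.exp (-(νB * d (p₃ k) (p₂ j))) * Real.exp (-(νA * d (p₂ j) (p₁ i)))) := by
    intro j
    have h2 : ‖W j‖ ≤ CA * Real.exp (-(μA * d (p₂ j) (p₁ i))) * ‖Z‖ := hA i Z j
    have h3 := exp_mul_exp_le_of_triangle (hd0 (p₃ k) (p₂ j)) (hd0 (p₂ j) (p₁ i)) (hdt (p₃ k) (p₂ j) (p₁ i)) hr hνA hνB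
    calc ‖e₃.symm (B (e₂ (Pi.single j (W j)))) k‖
        ≤ CB * Real.exp (-(μB * d (p₃ k) (p₂ j))) * ‖W j‖ := hB j (W j) k
      _ ≤ CB * Real.exp (-(μB * d (p₃ k) (p₂ j))) * (CA * Real.exp (-(μA * d (p₂ j) (p₁ i))) * ‖Z‖) :=
          mul_le_mul_of_nonneg_left h2 (by positivity)
      _ = CB * CA * ‖Z‖ * (Real.exp (-(μB * d (p₃ k) (p₂ j))) * Real.exp (-(μA * d (p₂ j) (p₁ i)))) := by ring
      _ ≤ CB * CA * ‖Z‖ * (Real.exp (-(r * d (p₃ k) (p₁ i))) * (Real.exp (-(νB * d (p₃ k) (p₂ j))) * Real.exp (-(νA * d (p₂ j) (p₁ i))))) :=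
          mul_le_mul_of_nonneg_left h3 (by positivity)
      _ = _ := by ring
  refine (Finset.sum_le_sum fun j _ => hterm j).trans ?_
  rw [← Finset.mul_sum]
  have hc : 0 ≤ CB * CA * ‖Z‖ * Real.exp (-(r * d (p₃ k) (p₁ i))) := by positivity
  calc CB * CA * ‖Z‖ * Real.exp (-(r * d (p₃ k) (p₁ i))) * ∑ j, Real.exp (-(νB * d (p₃ k) (p₂ j))) * Real.exp (-(νA * d (p₂ j) (p₁ i)))
      ≤ CB * CA * ‖Z‖ * Real.exp (-(r * d (p₃ k) (p₁ i))) * S := mul_le_mul_of_nonneg_left (hvol (p₃ k) (p₁ i)) hc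
    _ = CB * CA * S * Real.exp (-(r * d (p₃ k) (p₁ i))) * ‖Z‖ := by ring

/-- ★ **OUTER ABSORPTION**: the surplus rate of the SECOND factor `B` pays for the middle volume — `0 ≤ r ≤ μ_A`, `r + ν ≤ μ_B`, `Σ_j e^{−ν d(x, p₂ j)} ≤ S` ⟹ row `C_B·C_A·S` at rate `r`
(`B` = a tube row at a free rate, e.g. `Q_k†`, keeps `r = μ_A`). [cite: Balaban1984PropagatorsII, §2 (2.61) p.234] -/
theorem kernelRow_comp_outer (e₁ : (ι₁ → V) ≃ₗ[ℂ] E₁) (e₂ : (ι₂ → V) ≃ₗ[ℂ] E₂) (e₃ : (ι₃ → V) ≃ₗ[ℂ] E₃)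
    (d : X → X → ℝ) (hd0 : ∀ x y, 0 ≤ d x y) (hdt : ∀ x y z, d x z ≤ d x y + d y z)
    (p₁ : ι₁ → X) (p₂ : ι₂ → X) (p₃ : ι₃ → X) (A : E₁ →ₗ[ℂ] E₂) (B : E₂ →ₗ[ℂ] E₃)
    {CA CB μA μB r ν S : ℝ} (hCA : 0 ≤ CA) (hCB : 0 ≤ CB) (hr : 0 ≤ r) (hrA : r ≤ μA) (hν : r + ν ≤ μB)
    (hvol : ∀ x : X, ∑ j, Real.exp (-(ν * d x (p₂ j))) ≤ S)
    (hA : ∀ (i : ι₁) (Z : V) (j : ι₂), ‖e₂.symm (A (e₁ (Pi.single i Z))) j‖ ≤ CA * Real.exp (-(μA * d (p₂ j) (p₁ i))) * ‖Z‖)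
    (hB : ∀ (j : ι₂) (W : V) (k : ι₃), ‖e₃.symm (B (e₂ (Pi.single j W))) k‖ ≤ CB * Real.exp (-(μB * d (p₃ k) (p₂ j))) * ‖W‖)
    (i : ι₁) (Z : V) (k : ι₃) :
    ‖e₃.symm (B (A (e₁ (Pi.single i Z)))) k‖ ≤ CB * CA * S * Real.exp (-(r * d (p₃ k) (p₁ i))) * ‖Z‖ :=
  kernelRow_comp_core e₁ e₂ e₃ d hd0 hdt p₁ p₂ p₃ A B hCA hCB hr (νA := 0) (by linarith) hν
    (fun x z => by simpa only [zero_mul, neg_zero, Real.exp_zero, mul_one] using hvol x) hA hB i Z k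

/-- ★ **INNER ABSORPTION**: the surplus rate of the FIRST factor `A` pays — `0 ≤ r ≤ μ_B`, `r + ν ≤ μ_A`, `Σ_j e^{−ν d(p₂ j, z)} ≤ S` ⟹ row `C_B·C_A·S` at rate `r`. [cite: Balaban1984PropagatorsII, §2 (2.61) p.234] -/
theorem kernelRow_comp_inner (e₁ : (ι₁ → V) ≃ₗ[ℂ] E₁) (e₂ : (ι₂ → V) ≃ₗ[ℂ] E₂) (e₃ : (ι₃ → V) ≃ₗ[ℂ] E₃)
    (d : X → X → ℝ) (hd0 : ∀ x y, 0 ≤ d x y) (hdt : ∀ x y z, d x z ≤ d x y + d y z)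
    (p₁ : ι₁ → X) (p₂ : ι₂ → X) (p₃ : ι₃ → X) (A : E₁ →ₗ[ℂ] E₂) (B : E₂ →ₗ[ℂ] E₃)
    {CA CB μA μB r ν S : ℝ} (hCA : 0 ≤ CA) (hCB : 0 ≤ CB) (hr : 0 ≤ r) (hν : r + ν ≤ μA) (hrB : r ≤ μB)
    (hvol : ∀ z : X, ∑ j, Real.exp (-(ν * d (p₂ j) z)) ≤ S)
    (hA : ∀ (i : ι₁) (Z : V) (j : ι₂), ‖e₂.symm (A (e₁ (Pi.single i Z))) j‖ ≤ CA * Real.exp (-(μA * d (p₂ j) (p₁ i))) * ‖Z‖)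
    (hB : ∀ (j : ι₂) (W : V) (k : ι₃), ‖e₃.symm (B (e₂ (Pi.single j W))) k‖ ≤ CB * Real.exp (-(μB * d (p₃ k) (p₂ j))) * ‖W‖)
    (i : ι₁) (Z : V) (k : ι₃) :
    ‖e₃.symm (B (A (e₁ (Pi.single i Z)))) k‖ ≤ CB * CA * S * Real.exp (-(r * d (p₃ k) (p₁ i))) * ‖Z‖ :=
  kernelRow_comp_core e₁ e₂ e₃ d hd0 hdt p₁ p₂ p₃ A B hCA hCB hr hν (νB := 0) (by linarith)
    (fun x z => by simpa only [zero_mul, neg_zero, Real.exp_zero, one_mul] using hvol z) hA hB i Z k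

end Abstract

/-! ## §1 The member: positions on the coarse torus and the fine volume -/

section Member
variable (F : T3Family) {n K : ℕ} (h : n ≤ K) (c₀ cB : ℝ)

/-- **THE FINE VOLUME SEEN FROM THE COARSE TORUS**: `Σ_{b : fine bonds} e^{−ν·dc(x, B b)} ≤ d·(L^d)^{K−n}·(2(1+1∕ν))³` — `d(L^d)^{K−n}` bonds per block (px10 g12 ✓`sum_pbond_blockwise`) times the
coarse exponential volume (✓`sum_exp_neg_mul_tdist_coarse_le`). At `d = 3`: `3ℓ³·(2(1+1∕ν))³`, the `ℓ³` that the `ℓ⁻³` of `Q_k`'s tube row eats. [cite: Balaban1985BackgroundPropagators, (3.49) p.399; Balaban1985Averaging, (2) p.17] -/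
theorem sum_pbond_exp_neg_tdist_le {ν : ℝ} (hν : 0 < ν) (x : Site (F.P K) (K - n)) :
    ∑ b : PBond (F.P K) 0, Real.exp (-(ν * (Site.tdist (P := F.P K) x (iterBlockOf (K - n) b.src) : ℝ)))
      ≤ ((F.P K).d : ℝ) * ((((F.P K).L : ℝ) ^ (F.P K).d) ^ (K - n)) * (2 * (1 + 1 / ν)) ^ 3 := by
  rw [sum_pbond_blockwise F (fun z : Site (F.P K) (K - n) => Real.exp (-(ν * (Site.tdist (P := F.P K) x z : ℝ))))]
  refine mul_le_mul_of_nonneg_left ?_ (by positivity)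
  have hs := sum_exp_neg_mul_tdist_coarse_le F (n := n) (K := K) hν x
  refine le_trans (le_of_eq (Finset.sum_congr rfl fun z _ => ?_)) hs
  rw [tdist_coarse_comm]

/-- Read set ⟹ adjacent blocks: if `B(b) ∈ {ŷ′, ŷ′⁺}` then `dc(B b, ŷ′) ≤ 1` (✓`bondShift_src`, ✓`tdist_src_tgt_le_one`). [cite: Balaban1985BackgroundPropagators, (3.13) p.393] -/
theorem tdist_le_one_of_read (y' : PBond (F.P n) 0) (b : PBond (F.P K) 0)
    (hb : iterBlockOf (K - n) b.src = (bondShift (sites_eq F n K h) y').src ∨ iterBlockOf (K - n) b.src = (bondShift (sites_eq F n K h) y').tgt) :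
    (Site.tdist (P := F.P K) (iterBlockOf (K - n) b.src) (siteShift (sites_eq F n K h) y'.src) : ℝ) ≤ 1 := by
  have h1 : Site.tdist (P := F.P K) (iterBlockOf (K - n) b.src) (siteShift (sites_eq F n K h) y'.src) ≤ 1 := by
    rcases hb with hb | hb
    · rw [hb, bondShift_src]; simp [Site.tdist]
    · rw [hb, ← bondShift_src, B3Taylor310LocalRemainder.tdist_comm]; exact tdist_src_tgt_le_one _
  exact_mod_cast h1

/-- On adjacent blocks the exponential weight costs at most `e^{μ}`: `t ≤ 1`, `0 ≤ μ` ⟹ `1 ≤ e^{μ}·e^{−μ t}`. [folklore] -/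
theorem one_le_exp_mul_exp_neg {μ t : ℝ} (hμ : 0 ≤ μ) (ht : t ≤ 1) : 1 ≤ Real.exp μ * Real.exp (-(μ * t)) := by rw [← Real.exp_add]; exact Real.one_le_exp (by nlinarith)

/-! ## §2 ★ The four member-level compositions -/

/-- ★ **CF ∘ CC (outer absorption)** — the shape of the rows `h137kπ`∕`h137kΔ`: `T` coarse→fine with CF(T; C_T, μ_T), `M` coarse→coarse with CC(M; C_M, μ_M), `0 ≤ r ≤ μ_M`, `0 < ν`,
`r + ν ≤ μ_T` ⟹ CF(T ∘ M; C_T·C_M·3(2(1+1∕ν))³, r). [cite: Balaban1985BackgroundPropagators, (3.124)–(3.126) p.420, (3.132)–(3.133) p.422; Balaban1984PropagatorsII, (2.61) p.234] -/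
theorem kernelRow_CF_comp_CC (T : WL2 ℂ (fun _ : PBond (F.P n) 0 => cB) W₂ →ₗ[ℂ] BondL2K ℂ 3 (periodsT3 F K) c₀ W₂)
    (M : WL2 ℂ (fun _ : PBond (F.P n) 0 => cB) W₂ →ₗ[ℂ] WL2 ℂ (fun _ : PBond (F.P n) 0 => cB) W₂)
    {CT CM μT μM r ν : ℝ} (hCT : 0 ≤ CT) (hCM : 0 ≤ CM) (hr : 0 ≤ r) (hrM : r ≤ μM) (hν : 0 < ν) (hrT : r + ν ≤ μT)
    (hT : ∀ (y : PBond (F.P n) 0) (Z : Matrix (Fin 2) (Fin 2) ℂ) (b : PBond (F.P K) 0),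
      ‖(toL2 F K c₀).symm (T (toL2B F n cB (Pi.single y Z))) b‖
        ≤ CT * Real.exp (-(μT * (Site.tdist (P := F.P K) (iterBlockOf (K - n) b.src) (siteShift (sites_eq F n K h) y.src) : ℝ))) * ‖Z‖)
    (hM : ∀ (y : PBond (F.P n) 0) (Z : Matrix (Fin 2) (Fin 2) ℂ) (y' : PBond (F.P n) 0),
      ‖(toL2B F n cB).symm (M (toL2B F n cB (Pi.single y Z))) y'‖
        ≤ CM * Real.exp (-(μM * (Site.tdist (P := F.P K) (siteShift (sites_eq F n K h) y'.src) (siteShift (sites_eq F n K h) y.src) : ℝ))) * ‖Z‖)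
    (y : PBond (F.P n) 0) (Z : Matrix (Fin 2) (Fin 2) ℂ) (b : PBond (F.P K) 0) :
    ‖(toL2 F K c₀).symm ((T ∘ₗ M) (toL2B F n cB (Pi.single y Z))) b‖
      ≤ CT * CM * (3 * (2 * (1 + 1 / ν)) ^ 3)
          * Real.exp (-(r * (Site.tdist (P := F.P K) (iterBlockOf (K - n) b.src) (siteShift (sites_eq F n K h) y.src) : ℝ))) * ‖Z‖ := by
  classical
  rw [LinearMap.comp_apply]
  exact kernelRow_comp_outer (toL2B F n cB) (toL2B F n cB) (toL2 F K c₀) (fun x z : Site (F.P K) (K - n) => (Site.tdist x z : ℝ))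
    (fun _ _ => Nat.cast_nonneg _) (tdist_coarse_triangle F) (fun y : PBond (F.P n) 0 => siteShift (sites_eq F n K h) y.src)
    (fun y : PBond (F.P n) 0 => siteShift (sites_eq F n K h) y.src) (fun b : PBond (F.P K) 0 => iterBlockOf (K - n) b.src) M T hCM hCT hr hrM hrT
    (fun x => sum_coarse_pbond_exp_neg_tdist_le F n K h x hν) hM hT y Z b

/-- ★ **FC ∘ FF (outer absorption)** — the shape of `Q_k ∘ G_T`: `S` fine→coarse with FC(S; C_S, μ_S), `B` fine→fine with FF(B; C_B, μ_B) (px10 g12's ROW text), `0 ≤ r ≤ μ_B`, `0 < ν`,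
`r + ν ≤ μ_S` ⟹ FC(S ∘ B; C_S·C_B·(d(L^d)^{K−n}(2(1+1∕ν))³), r) — at the pins `C_S = 5ℓ⁻³e^{μ_S}` and the fine volume's `3ℓ³` cancel. [cite: Balaban1985BackgroundPropagators, (3.46)–(3.49) pp.398–399, (3.147) p.425; Balaban1984PropagatorsII, (2.61) p.234] -/
theorem kernelRow_FC_comp_FF (S : BondL2K ℂ 3 (periodsT3 F K) c₀ W₂ →ₗ[ℂ] WL2 ℂ (fun _ : PBond (F.P n) 0 => cB) W₂)
    (B : BondL2K ℂ 3 (periodsT3 F K) c₀ W₂ →ₗ[ℂ] BondL2K ℂ 3 (periodsT3 F K) c₀ W₂)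
    {CS CB μS μB r ν : ℝ} (hCS : 0 ≤ CS) (hCB : 0 ≤ CB) (hr : 0 ≤ r) (hrB : r ≤ μB) (hν : 0 < ν) (hrS : r + ν ≤ μS)
    (hS : ∀ (b : PBond (F.P K) 0) (Z : Matrix (Fin 2) (Fin 2) ℂ) (y' : PBond (F.P n) 0),
      ‖(toL2B F n cB).symm (S (toL2 F K c₀ (Pi.single b Z))) y'‖
        ≤ CS * Real.exp (-(μS * (Site.tdist (P := F.P K) (siteShift (sites_eq F n K h) y'.src) (iterBlockOf (K - n) b.src) : ℝ))) * ‖Z‖)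
    (hB : ∀ (b : PBond (F.P K) 0) (Z : Matrix (Fin 2) (Fin 2) ℂ) (bd : PBond (F.P K) 0),
      ‖(toL2 F K c₀).symm (B (toL2 F K c₀ (Pi.single b Z))) bd‖
        ≤ CB * Real.exp (-(μB * (Site.tdist (P := F.P K) (iterBlockOf (K - n) b.src) (iterBlockOf (K - n) bd.src) : ℝ))) * ‖Z‖)
    (b : PBond (F.P K) 0) (Z : Matrix (Fin 2) (Fin 2) ℂ) (y' : PBond (F.P n) 0) :
    ‖(toL2B F n cB).symm ((S ∘ₗ B) (toL2 F K c₀ (Pi.single b Z))) y'‖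
      ≤ CS * CB * (((F.P K).d : ℝ) * ((((F.P K).L : ℝ) ^ (F.P K).d) ^ (K - n)) * (2 * (1 + 1 / ν)) ^ 3)
          * Real.exp (-(r * (Site.tdist (P := F.P K) (siteShift (sites_eq F n K h) y'.src) (iterBlockOf (K - n) b.src) : ℝ))) * ‖Z‖ := by
  classical
  rw [LinearMap.comp_apply]
  exact kernelRow_comp_outer (toL2 F K c₀) (toL2 F K c₀) (toL2B F n cB) (fun x z : Site (F.P K) (K - n) => (Site.tdist x z : ℝ))
    (fun _ _ => Nat.cast_nonneg _) (tdist_coarse_triangle F) (fun b : PBond (F.P K) 0 => iterBlockOf (K - n) b.src)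
    (fun b : PBond (F.P K) 0 => iterBlockOf (K - n) b.src) (fun y : PBond (F.P n) 0 => siteShift (sites_eq F n K h) y.src) B S hCB hCS hr hrB hrS
    (fun x => sum_pbond_exp_neg_tdist_le F hν x) (fun b Z bd => by rw [tdist_coarse_comm]; exact hB b Z bd) hS b Z y'

/-- ★ **CC ∘ FC (outer absorption)** — the shape of `K⁻¹ ∘ (Q_kG_T)`: `M` coarse→coarse with CC(M; C_M, μ_M), `S` fine→coarse with FC(S; C_S, μ_S), `0 ≤ r ≤ μ_S`, `0 < ν`, `r + ν ≤ μ_M`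
⟹ FC(M ∘ S; C_M·C_S·3(2(1+1∕ν))³, r). [cite: Balaban1985BackgroundPropagators, (3.132)–(3.133) p.422, (3.147) p.425; Balaban1984PropagatorsII, (2.61) p.234] -/
theorem kernelRow_CC_comp_FC (M : WL2 ℂ (fun _ : PBond (F.P n) 0 => cB) W₂ →ₗ[ℂ] WL2 ℂ (fun _ : PBond (F.P n) 0 => cB) W₂)
    (S : BondL2K ℂ 3 (periodsT3 F K) c₀ W₂ →ₗ[ℂ] WL2 ℂ (fun _ : PBond (F.P n) 0 => cB) W₂)
    {CM CS μM μS r ν : ℝ} (hCM : 0 ≤ CM) (hCS : 0 ≤ CS) (hr : 0 ≤ r) (hrS : r ≤ μS) (hν : 0 < ν) (hrM : r + ν ≤ μM)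
    (hM : ∀ (y : PBond (F.P n) 0) (Z : Matrix (Fin 2) (Fin 2) ℂ) (y' : PBond (F.P n) 0),
      ‖(toL2B F n cB).symm (M (toL2B F n cB (Pi.single y Z))) y'‖
        ≤ CM * Real.exp (-(μM * (Site.tdist (P := F.P K) (siteShift (sites_eq F n K h) y'.src) (siteShift (sites_eq F n K h) y.src) : ℝ))) * ‖Z‖)
    (hS : ∀ (b : PBond (F.P K) 0) (Z : Matrix (Fin 2) (Fin 2) ℂ) (y' : PBond (F.P n) 0),
      ‖(toL2B F n cB).symm (S (toL2 F K c₀ (Pi.single b Z))) y'‖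
        ≤ CS * Real.exp (-(μS * (Site.tdist (P := F.P K) (siteShift (sites_eq F n K h) y'.src) (iterBlockOf (K - n) b.src) : ℝ))) * ‖Z‖)
    (b : PBond (F.P K) 0) (Z : Matrix (Fin 2) (Fin 2) ℂ) (y' : PBond (F.P n) 0) :
    ‖(toL2B F n cB).symm ((M ∘ₗ S) (toL2 F K c₀ (Pi.single b Z))) y'‖
      ≤ CM * CS * (3 * (2 * (1 + 1 / ν)) ^ 3)
          * Real.exp (-(r * (Site.tdist (P := F.P K) (siteShift (sites_eq F n K h) y'.src) (iterBlockOf (K - n) b.src) : ℝ))) * ‖Z‖ := by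
  classical
  rw [LinearMap.comp_apply]
  exact kernelRow_comp_outer (toL2 F K c₀) (toL2B F n cB) (toL2B F n cB) (fun x z : Site (F.P K) (K - n) => (Site.tdist x z : ℝ))
    (fun _ _ => Nat.cast_nonneg _) (tdist_coarse_triangle F) (fun b : PBond (F.P K) 0 => iterBlockOf (K - n) b.src)
    (fun y : PBond (F.P n) 0 => siteShift (sites_eq F n K h) y.src) (fun y : PBond (F.P n) 0 => siteShift (sites_eq F n K h) y.src) S M hCS hCM hr hrS hrM
    (fun x => sum_coarse_pbond_exp_neg_tdist_le F n K h x hν) hS hM b Z y'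

/-- ★ **CF ∘ FC → FF (outer absorption)** — the shape of the tube term `Q_k†(K⁻¹Q_kG_T)` (row `hCk`, px10 g12's FF text): `T` coarse→fine with CF(T; C_T, μ_T), `S` fine→coarse with
FC(S; C_S, μ_S), `0 ≤ r ≤ μ_S`, `0 < ν`, `r + ν ≤ μ_T` ⟹ FF(T ∘ S; C_T·C_S·3(2(1+1∕ν))³, r). [cite: Balaban1985BackgroundPropagators, (3.147)–(3.153) pp.425–426, (3.132)–(3.133) p.422; Balaban1984PropagatorsII, (2.61) p.234] -/
theorem kernelRow_CF_comp_FC (T : WL2 ℂ (fun _ : PBond (F.P n) 0 => cB) W₂ →ₗ[ℂ] BondL2K ℂ 3 (periodsT3 F K) c₀ W₂)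
    (S : BondL2K ℂ 3 (periodsT3 F K) c₀ W₂ →ₗ[ℂ] WL2 ℂ (fun _ : PBond (F.P n) 0 => cB) W₂)
    {CT CS μT μS r ν : ℝ} (hCT : 0 ≤ CT) (hCS : 0 ≤ CS) (hr : 0 ≤ r) (hrS : r ≤ μS) (hν : 0 < ν) (hrT : r + ν ≤ μT)
    (hT : ∀ (y : PBond (F.P n) 0) (Z : Matrix (Fin 2) (Fin 2) ℂ) (b : PBond (F.P K) 0),
      ‖(toL2 F K c₀).symm (T (toL2B F n cB (Pi.single y Z))) b‖
        ≤ CT * Real.exp (-(μT * (Site.tdist (P := F.P K) (iterBlockOf (K - n) b.src) (siteShift (sites_eq F n K h) y.src) : ℝ))) * ‖Z‖)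
    (hS : ∀ (b : PBond (F.P K) 0) (Z : Matrix (Fin 2) (Fin 2) ℂ) (y' : PBond (F.P n) 0),
      ‖(toL2B F n cB).symm (S (toL2 F K c₀ (Pi.single b Z))) y'‖
        ≤ CS * Real.exp (-(μS * (Site.tdist (P := F.P K) (siteShift (sites_eq F n K h) y'.src) (iterBlockOf (K - n) b.src) : ℝ))) * ‖Z‖)
    (b : PBond (F.P K) 0) (Z : Matrix (Fin 2) (Fin 2) ℂ) (bd : PBond (F.P K) 0) :
    ‖(toL2 F K c₀).symm ((T ∘ₗ S) (toL2 F K c₀ (Pi.single b Z))) bd‖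
      ≤ CT * CS * (3 * (2 * (1 + 1 / ν)) ^ 3)
          * Real.exp (-(r * (Site.tdist (P := F.P K) (iterBlockOf (K - n) b.src) (iterBlockOf (K - n) bd.src) : ℝ))) * ‖Z‖ := by
  classical
  rw [LinearMap.comp_apply, tdist_coarse_comm]
  exact kernelRow_comp_outer (toL2 F K c₀) (toL2B F n cB) (toL2 F K c₀) (fun x z : Site (F.P K) (K - n) => (Site.tdist x z : ℝ))
    (fun _ _ => Nat.cast_nonneg _) (tdist_coarse_triangle F) (fun b : PBond (F.P K) 0 => iterBlockOf (K - n) b.src)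
    (fun y : PBond (F.P n) 0 => siteShift (sites_eq F n K h) y.src) (fun b : PBond (F.P K) 0 => iterBlockOf (K - n) b.src) S T hCS hCT hr hrS hrT
    (fun x => sum_coarse_pbond_exp_neg_tdist_le F n K h x hν) hS hT b Z bd

/-! ## §3 ★★ The tube rows of `Q_k(U₀)` and `Q_k(U₀)†` at a printed-regular background -/

/-- Unfolding: the coarse readback of `Q_k(U₀)(toL2 X)` is `η • QTwS U₀ X` (✓`Qk_toL2`). [cite: Balaban1985Variational, (44)–(45) p.285] -/
theorem toL2B_symm_Qk_toL2_apply (U₀ : GaugeField (F.P K) 0 (Matrix.specialUnitaryGroup (Fin 2) ℂ)) (X : PBond (F.P K) 0 → Matrix (Fin 2) (Fin 2) ℂ) (y' : PBond (F.P n) 0) :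
    (toL2B F n cB).symm (Qk F n K h c₀ cB U₀ (toL2 F K c₀ X)) y' = ((eta F n K : ℝ) : ℂ) • QTwS F n K h U₀ X y' := by
  rw [Qk_toL2, LinearEquiv.map_smul, LinearEquiv.symm_apply_apply, Pi.smul_apply]

/-- ★★ **THE TUBE ROW OF `Q_k(U₀)` (fine → coarse), EVERY RATE, UNCONDITIONAL AT `RegPr`**: `RegPr F n K ε₀ U₀`, the two windows, `0 ≤ μ` ⟹ for every fine bond `b`, `Z ∈ M₂(ℂ)` and coarse
bond `y′`: `‖toL2B⁻¹(Q_k(U₀)(toL2(δ_b ⊗ Z)))(y′)‖ ≤ (5·ℓ⁻³·e^{μ})·e^{−μ·dc(ŷ′, B b)}·‖Z‖` — the entry is `η·(QTwS U₀ (δ_b ⊗ Z))(y′)`, one term of (COL) (✓`col_of_regPr`, `C_Q ≤ 5`), `η·ℓ⁻² = ℓ⁻³`;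
zero off the read set. [cite: Balaban1985BackgroundPropagators, (3.13)–(3.16) p.393; Balaban1985Variational, (44)–(45) p.285; Balaban1984PropagatorsI, (1.18) p.20] -/
theorem kernelRow_Qk_of_regPr {ε₀ : ℝ} (hε₀ : 0 < ε₀) (hε : 10 ^ 10 * (F.L : ℝ) ^ 6 * ε₀ ≤ 1) (hε12 : 10 ^ 12 * (F.L : ℝ) ^ 3 * ε₀ ≤ 1)
    (U₀ : GaugeField (F.P K) 0 (Matrix.specialUnitaryGroup (Fin 2) ℂ)) (hreg : RegPr F n K ε₀ U₀) {μ : ℝ} (hμ : 0 ≤ μ) :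
    ∀ (b : PBond (F.P K) 0) (Z : Matrix (Fin 2) (Fin 2) ℂ) (y' : PBond (F.P n) 0),
      ‖(toL2B F n cB).symm (Qk F n K h c₀ cB U₀ (toL2 F K c₀ (Pi.single b Z))) y'‖
        ≤ (5 * ((F.L : ℝ) ^ (K - n))⁻¹ ^ 3 * Real.exp μ)
          * Real.exp (-(μ * (Site.tdist (P := F.P K) (siteShift (sites_eq F n K h) y'.src) (iterBlockOf (K - n) b.src) : ℝ))) * ‖Z‖ := by
  classical
  intro b Z y'
  have hL0 : (0 : ℝ) < F.L := by exact_mod_cast lt_trans zero_lt_one F.hL.2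
  have hη : 0 < eta F n K := eta_pos F n K
  have hηℓ : eta F n K = ((F.L : ℝ) ^ (K - n))⁻¹ := by
    show ((F.L : ℝ)⁻¹) ^ (K - n) = ((F.L : ℝ) ^ (K - n))⁻¹; rw [inv_pow]
  rw [toL2B_symm_Qk_toL2_apply, norm_smul, Complex.norm_real, Real.norm_of_nonneg hη.le]
  by_cases hb : (iterBlockOf (K - n) b.src = (bondShift (sites_eq F n K h) y').src ∨ iterBlockOf (K - n) b.src = (bondShift (sites_eq F n K h) y').tgt)
  · have ht := tdist_le_one_of_read F h y' b hb
    rw [tdist_coarse_comm] at ht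
    have hcol := col_of_regPr F h hε₀ hε hε12 U₀ hreg b Z
    have h5 := col_const_le_five F (K := K) hε₀ hε
    have hone : ‖QTwS F n K h U₀ (Pi.single b Z) y'‖ ≤ 5 * ((F.L : ℝ) ^ (K - n))⁻¹ ^ 2 * ‖Z‖ := by
      refine ((Finset.single_le_sum (f := fun c => ‖QTwS F n K h U₀ (Pi.single b Z) c‖) (fun _ _ => norm_nonneg _) (Finset.mem_univ y')).trans hcol).trans ?_
      have hK0 : 0 ≤ ((F.L : ℝ) ^ (K - n))⁻¹ ^ 2 * ‖Z‖ := by positivity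
      nlinarith [mul_le_mul_of_nonneg_right h5 hK0]
    have hmain : eta F n K * ‖QTwS F n K h U₀ (Pi.single b Z) y'‖ ≤ 5 * ((F.L : ℝ) ^ (K - n))⁻¹ ^ 3 * ‖Z‖ := by
      calc eta F n K * ‖QTwS F n K h U₀ (Pi.single b Z) y'‖ ≤ eta F n K * (5 * ((F.L : ℝ) ^ (K - n))⁻¹ ^ 2 * ‖Z‖) := mul_le_mul_of_nonneg_left hone hη.le
        _ = 5 * ((F.L : ℝ) ^ (K - n))⁻¹ ^ 3 * ‖Z‖ := by rw [hηℓ]; ring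
    have hZ0 : 0 ≤ 5 * ((F.L : ℝ) ^ (K - n))⁻¹ ^ 3 * ‖Z‖ := by positivity
    calc _ ≤ 5 * ((F.L : ℝ) ^ (K - n))⁻¹ ^ 3 * ‖Z‖ := hmain
      _ ≤ 5 * ((F.L : ℝ) ^ (K - n))⁻¹ ^ 3 * ‖Z‖ * (Real.exp μ
            * Real.exp (-(μ * (Site.tdist (P := F.P K) (siteShift (sites_eq F n K h) y'.src) (iterBlockOf (K - n) b.src) : ℝ)))) :=
          le_mul_of_one_le_right hZ0 (one_le_exp_mul_exp_neg hμ ht)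
      _ = _ := by ring
  · rw [QTwS_single_eq_zero_of_not_read F h hε₀ hε12 U₀ hreg b Z y' hb, norm_zero, mul_zero]
    positivity

variable [Fact (0 < c₀)] [Fact (0 < cB)]

/-- **THE `(b, y′)` ENTRY OF `Q_k(U₀)†` VANISHES OFF THE READ SET**: if `B(b) ∉ {ŷ′, ŷ′⁺}` then `toL2⁻¹(Q_k(U₀)†(toL2B(δ_{y′} ⊗ W)))(b) = 0` — test against the spike `δ_b ⊗ E(b)` (px17
✓`inner_toL2_single_adjoint_Qk`): the only summand is `tr((QTwS U₀ (δ_b ⊗ E b))(y′)ᴴ W) = 0` (px21 ✓`QTwS_single_eq_zero_of_not_read`). [cite: Balaban1985BackgroundPropagators, (3.13)–(3.16) p.393] -/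
theorem symm_adjoint_Qk_toL2B_single_eq_zero_of_not_read {ε₀ : ℝ} (hε₀ : 0 < ε₀) (hε12 : 10 ^ 12 * (F.L : ℝ) ^ 3 * ε₀ ≤ 1)
    (U₀ : GaugeField (F.P K) 0 (Matrix.specialUnitaryGroup (Fin 2) ℂ)) (hreg : RegPr F n K ε₀ U₀)
    (y' : PBond (F.P n) 0) (W : Matrix (Fin 2) (Fin 2) ℂ) (b : PBond (F.P K) 0)
    (hb : ¬ (iterBlockOf (K - n) b.src = (bondShift (sites_eq F n K h) y').src ∨ iterBlockOf (K - n) b.src = (bondShift (sites_eq F n K h) y').tgt)) :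
    (toL2 F K c₀).symm (LinearMap.adjoint (Qk F n K h c₀ cB U₀) (toL2B F n cB (Pi.single y' W))) b = 0 := by
  classical
  have hc₀ : 0 < c₀ := Fact.out
  set u := LinearMap.adjoint (Qk F n K h c₀ cB U₀) (toL2B F n cB (Pi.single y' W)) with hu
  set Ef : PBond (F.P K) 0 → Matrix (Fin 2) (Fin 2) ℂ := (toL2 F K c₀).symm u with hEf
  have huE : u = toL2 F K c₀ Ef := by rw [hEf, LinearEquiv.apply_symm_apply]
  -- the pairing of the spike at `b` with `u` vanishes
  have hpair : ⟪toL2 F K c₀ (Pi.single b (Ef b)), u⟫_ℂ = 0 := by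
    rw [hu, inner_toL2_single_adjoint_Qk F h c₀ cB U₀ (Pi.single y' W) b (Ef b)]
    have hsum : ∑ c : PBond (F.P n) 0, Matrix.trace ((QTwS F n K h U₀ (Pi.single b (Ef b)) c).conjTranspose
        * (Pi.single y' W : PBond (F.P n) 0 → Matrix (Fin 2) (Fin 2) ℂ) c) = 0 := by
      refine Finset.sum_eq_zero fun c _ => ?_
      by_cases hc : c = y'
      · subst hc
        rw [QTwS_single_eq_zero_of_not_read F h hε₀ hε12 U₀ hreg b (Ef b) c hb, Matrix.conjTranspose_zero, Matrix.zero_mul, Matrix.trace_zero]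
      · rw [Pi.single_eq_of_ne hc, Matrix.mul_zero, Matrix.trace_zero]
    rw [hsum, mul_zero]
  -- hence `Ef b = 0`
  have hself := inner_toL2_single_self F c₀ Ef b
  rw [← huE, hpair] at hself
  have hn : c₀ * ‖(frobEquiv.symm (Ef b) : W₂)‖ ^ 2 = 0 := by exact_mod_cast hself.symm
  have hz : ‖(frobEquiv.symm (Ef b) : W₂)‖ = 0 := by
    have := (mul_eq_zero.mp hn).resolve_left hc₀.ne'
    exact pow_eq_zero_iff (n := 2) (by norm_num) |>.mp this
  have hE0 : (frobEquiv.symm (Ef b) : W₂) = 0 := norm_eq_zero.mp hz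
  have : Ef b = 0 := by
    have := congrArg frobEquiv hE0
    rw [LinearEquiv.apply_symm_apply, map_zero] at this
    exact this
  rw [hEf] at this
  exact this

/-- ★★ **THE TUBE ROW OF `Q_k(U₀)†` (coarse → fine), EVERY RATE, UNCONDITIONAL AT `RegPr`**: `RegPr F n K ε₀ U₀`, the two windows, `0 ≤ μ` ⟹ for every coarse bond `y′`, `W ∈ M₂(ℂ)` and fine
bond `b`: `‖toL2⁻¹(Q_k(U₀)†(toL2B(δ_{y′} ⊗ W)))(b)‖ ≤ (2·5·(cB∕c₀)·ℓ⁻³·e^{μ})·e^{−μ·dc(B b, ŷ′)}·‖W‖` — size = px13's unconditional sup row (`C_Q ≤ 5`) on the spike, decay = tube locality; at the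
pins `cB∕c₀ = ℓ³`: `10e^{μ}`, K-FREE. [cite: Balaban1985BackgroundPropagators, (3.13)–(3.16) p.393, (3.124)–(3.126) p.420; Balaban1984PropagatorsI, (1.18) p.20] -/
theorem kernelRow_adjoint_Qk_of_regPr {ε₀ : ℝ} (hε₀ : 0 < ε₀) (hε : 10 ^ 10 * (F.L : ℝ) ^ 6 * ε₀ ≤ 1) (hε12 : 10 ^ 12 * (F.L : ℝ) ^ 3 * ε₀ ≤ 1)
    (U₀ : GaugeField (F.P K) 0 (Matrix.specialUnitaryGroup (Fin 2) ℂ)) (hreg : RegPr F n K ε₀ U₀) {μ : ℝ} (hμ : 0 ≤ μ) :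
    ∀ (y' : PBond (F.P n) 0) (W : Matrix (Fin 2) (Fin 2) ℂ) (b : PBond (F.P K) 0),
      ‖(toL2 F K c₀).symm (LinearMap.adjoint (Qk F n K h c₀ cB U₀) (toL2B F n cB (Pi.single y' W))) b‖
        ≤ (2 * 5 * (cB / c₀) * ((F.L : ℝ) ^ (K - n))⁻¹ ^ 3 * Real.exp μ)
          * Real.exp (-(μ * (Site.tdist (P := F.P K) (iterBlockOf (K - n) b.src) (siteShift (sites_eq F n K h) y'.src) : ℝ))) * ‖W‖ := by
  classical
  intro y' W b
  have hc₀ : 0 < c₀ := Fact.out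
  have hcB : 0 < cB := Fact.out
  have hL0 : (0 : ℝ) < F.L := by exact_mod_cast lt_trans zero_lt_one F.hL.2
  by_cases hb : (iterBlockOf (K - n) b.src = (bondShift (sites_eq F n K h) y').src ∨ iterBlockOf (K - n) b.src = (bondShift (sites_eq F n K h) y').tgt)
  · have ht := tdist_le_one_of_read F h y' b hb
    have hrow := norm_toL2_symm_adjoint_Qk_apply_le_of_regPr F h c₀ cB hε₀ hε hε12 U₀ hreg (Pi.single y' W) b
    rw [Pi.norm_single] at hrow
    have h5 := col_const_le_five F (K := K) hε₀ hε
    have hK0 : 0 ≤ (cB / c₀) * ((F.L : ℝ) ^ (K - n))⁻¹ ^ 3 * ‖W‖ := by positivity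
    have hmain : ‖(toL2 F K c₀).symm (LinearMap.adjoint (Qk F n K h c₀ cB U₀) (toL2B F n cB (Pi.single y' W))) b‖
        ≤ 2 * 5 * (cB / c₀) * ((F.L : ℝ) ^ (K - n))⁻¹ ^ 3 * ‖W‖ := by
      refine hrow.trans ?_
      have := mul_le_mul_of_nonneg_right h5 hK0
      nlinarith [this]
    have hZ0 : 0 ≤ 2 * 5 * (cB / c₀) * ((F.L : ℝ) ^ (K - n))⁻¹ ^ 3 * ‖W‖ := by positivity
    calc _ ≤ 2 * 5 * (cB / c₀) * ((F.L : ℝ) ^ (K - n))⁻¹ ^ 3 * ‖W‖ := hmain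
      _ ≤ 2 * 5 * (cB / c₀) * ((F.L : ℝ) ^ (K - n))⁻¹ ^ 3 * ‖W‖ * (Real.exp μ
            * Real.exp (-(μ * (Site.tdist (P := F.P K) (iterBlockOf (K - n) b.src) (siteShift (sites_eq F n K h) y'.src) : ℝ)))) :=
          le_mul_of_one_le_right hZ0 (one_le_exp_mul_exp_neg hμ ht)
      _ = _ := by ring
  · rw [symm_adjoint_Qk_toL2B_single_eq_zero_of_not_read F h c₀ cB hε₀ hε12 U₀ hreg y' W b hb, norm_zero]
    positivity

end Member

end Summit.QuantumFields.YangMills.Theorems.Prop7CoarseFineKernelRows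

end
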